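import Summits.QuantumFields.BalabanUV.Beta.D1BFx.RoadEndBFxRoadScalesJ3S
import Summits.QuantumFields.BalabanUV.Beta.D1BFx.CoframeTableMassScales

/-!
# Road «BF-x» — THE END AT THE ROAD's OBJECTS ON THE SCALES, (C1) AND (C2) DISCHARGED, (J3) IN CLOSED FORM: NO CO-FRAME LETTER LEFT (PART 17)

PART 16 (`RoadEndBFxRoadScalesJ3S`) still displays the co-frame TABLE letter (C2) «TB4-W CO-FRAME TABLE, m-UNIFORM MASS» on the scales (`hκc hCs' hCm` on
`cofPairInf (Lc^k) a (colH G₀ μ 0) (colH G₀ ν z)`).  leaf-03 g25's part 6 `CoframeTableMassScales.exists_C2_letters` (the objects-side junction of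
gan24-leaf-05 g54's m-UNIFORM letter δ4b `CoframeMassUniform.exists_totMass_cofPairInf_uniform` over δ1–δ4a ∕ γ1–γ3 — lit-balaban's lattice potential theory +
`ℓ¹` bookkeeping, kernel-checked) PROVES that triple for the road's own per-scale roots `r (Lc^k)` from exactly PART 14's root hypothesis `hr`, with the rate
`κc` and the table `mC` as witnesses.  THIS FILE consumes it BY NAME: PART 16 with `{κc mC} hκc hCs' hCm` REMOVED (five binders), nothing added.  AFTER THIS
FILE the (K) slot's (II) ledger displays NO co-frame letter: what remains is (J1) S-LIT, (J2) Q-DICT-N (+ `RJ2` rows; the TB4-Q binding is road-side, PART 18),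
the (C3) rows `hMRB hCB` of the four `Q′`-words of the closed-form (J3), the GHOST NORMALISATION GAP ROW `hGap` (F-g20-1; an2 R-D1-g41-2: tests (T1)(T3), (J1)'s
units), the units `uS uT`, the floors `δS₀ δ₂₀` ((L0): N-uniform propagator decay — in print, not in the tree), and the END's own sockets ∕ pins ∕ ray ∕ [P1′][P2′].

HONEST DEPENDENCY (page 1, mandatory): continuum YM on T⁴ ⇐ BetaPertH ∧ nine spine estimates (0/9 proved); BetaPertH ⇐ (D1) ∧ (D4) ∧ CAP+tail;
G-an2-4 gates asym, D1 and NE2/3/4.  HONEST FRAMING: discharging `BetaPertH` makes Bałaban's UV stability UNCONDITIONAL — NOT the continuum limit and NOT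
the Clay problem.  THIS FILE: [folklore] plumbing BY NAME (one `obtain` + one `exact` of PART 16); the analytic input consumed is leaf-03 g25's part 6 over
gan24-leaf-05 g54's δ-chain; (K) is NOT closed — (J1), (J2) (+ `RJ2` rows), (C3) `hMRB hCB` and `hGap` are HYPOTHESES; 0 root-level binders of row D1 discharged;
`D1Rep` is CONCLUDED only from the displayed binders; NOT D1, NOT BetaPertH, NOT continuum, NOT Clay.  [B5] Prop. 1.2 ∕ (1.26)–(1.27) BY NAME (`h12 h126`).
ABSOLUTE RULE (cell charter, verbatim): «No internally-minted statement may enter as a cited fact. Every hypothesis is either kernel-proved in this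
package or a verbatim quotation of a PUBLISHED theorem with page reference. The manuscript(s) under audit are NOT citable for their own disputed
steps — they are the thing under adjudication; programme-internal (2001/route/tribunal) claims are never citable.»  No `def … : Prop`; 0 `def`; 0 sorry.
Unit `b2b-balaban-beta-d1-p2` (road «BF-x» OWNER), gen 20, PART 17; leaf-03 g25's part 6 consumed BY NAME (their INTENT-4).
-/

noncomputable section

open Finset Filter Topology
open scoped BigOperators
open Literature.MathematicalPhysics.QuantumFieldTheory.Balaban1983to89
open Literature.MathematicalPhysics.QuantumFieldTheory.Balaban1983to89.Beta
open OneStepResolventKernel (JetData KInv)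
open OneStepKernelFamily (TbalOf TshotOf flipK D1Tel D1Rep)
open PolarizationSign (WardTransversal AxisReflectionCovariant)
open InterLevelTransport (onLat)
open BalabanStepJets (lamCoeffOf)
open AveragingHessianKernels (hessFF)
open KernelWard (divV)
open B12Sec2to5 (l1)
open DyadicShell (supNorm)
open ExpKernelCalculus (Site MKer BiLoc shiftK comp)
open DecimatedMomentSummable (AbsMoment₂)
open Summit.QuantumFields.BalabanUV.Beta.TameKernelCalculus (Loc trK)
open Summit.QuantumFields.BalabanUV.Beta.D1BFx.ReducedKernel (TableR TOfRed)
open Summit.QuantumFields.BalabanUV.Beta.D1BFx.DressedTadpoleTable (tableRed)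
open Summit.QuantumFields.BalabanUV.Beta.D1BFx.ReducedKernelSandwich (fineHess)
open Summit.QuantumFields.BalabanUV.Beta.D1BFx.FineStencilBF (ffOf)
open Summit.QuantumFields.BalabanUV.Beta.D1BFx.FineStencilBFBalaban (SbfBal)
open Summit.QuantumFields.BalabanUV.Beta.D1BFx.SecondStencilBF (Wbf)
open Summit.QuantumFields.BalabanUV.Beta.D1BFx.GhostKernelComplete (PghQ absMoment₂_PghQ)
open Summit.QuantumFields.BalabanUV.Beta.D1BFx.GluonLeg (Ga)
open Summit.QuantumFields.BalabanUV.Beta.D1BFx.FrozenLegTails (nOf MOf hn1)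
open VectorTailsLoc (fam kfam)
open Matrix Filter Topology
open scoped BigOperators Kronecker
open Literature.MathematicalPhysics.QuantumFieldTheory.Balaban1983to89.Beta.Composition (kkt)
open B12Sec2to5 (l1)
open ExpKernelCalculus (MKer BiLoc comp hessKer shiftK Site)
open OneStepKernelFamily (KInvStep colH vertexOfK TshotOf)
open Summit.QuantumFields.BalabanUV.Beta.AxialDressingRooted (coDressKBmAt coProjBmAtK)
open Summit.QuantumFields.BalabanUV.Beta.D1BFx.SortedKernels (fTL fBL)
open Summit.QuantumFields.BalabanUV.Beta.D1BFx.PackedNSideDictionary (SN)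
open Summit.QuantumFields.BalabanUV.Beta.D1BFx.PackedNSidePair (W2NInf)
open AffineAveraging (box toSite)
open OneStepResolventKernel (Fib wsum LocStencil)
open SecondOrderResponse (vertex2OfK)
open Summit.QuantumFields.BalabanUV.Beta.D1BFx.FibredPeriodisation (periodiseF)
open Summit.QuantumFields.BalabanUV.Beta.D1BFx.SortedPack (sortK)
open Summit.QuantumFields.BalabanUV.Beta.D1BFx.SortedReblocking (torusBlockEquiv)
open Summit.QuantumFields.BalabanUV.Beta.D1BFx.SortedEmbedding (e₁)
open Summit.QuantumFields.BalabanUV.Beta.D1BFx.PeriodicArrays (arr)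
open Summit.QuantumFields.BalabanUV.Beta.D1BFx.TorusCombKKT (I J CombRows Khat Qhat)
open Summit.QuantumFields.BalabanUV.Beta.D1BFx.TorusGaugeBasis (What0)
open Summit.QuantumFields.BalabanUV.Beta.D1BFx.TorusGaugeBasisMatrix (Nhat)
open Summit.QuantumFields.BalabanUV.Beta.D1BFx.TorusCoframeJets (Djet)
open Summit.QuantumFields.BalabanUV.Beta.D1BFx.GhostStencil (ghCur)
open Summit.QuantumFields.BalabanUV.Beta.D1BFx.WardJetsFromNoether (oslot)
open Summit.QuantumFields.BalabanUV.Beta.D1BFx.ColourLiftAdE3 (c₃)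
open Summit.QuantumFields.BalabanUV.Beta.D1BFx.PackedKernelSplit (blk ffW)
open Summit.QuantumFields.BalabanUV.Beta.D1BFx.ReducedKernelF (TOfLeg)
open Summit.QuantumFields.BalabanUV.Beta.D1BFx.GhostLeg (Ggh)
open OneStepResolventKernel (JetData)
open Summit.QuantumFields.BalabanUV.Beta.D1BFx.ReducedKernel (TOfRed)
open Summit.QuantumFields.BalabanUV.Beta.D1BFx.GhostKernelComplete (PghQ)
open Summit.QuantumFields.BalabanUV.Beta.D1BFx.FineStencilBFBalaban (SbfBal)
open Summit.QuantumFields.BalabanUV.Beta.D1BFx.SecondStencilBF (Wbf)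
open Summit.QuantumFields.BalabanUV.Beta.D1BFx.DressedTadpoleTable (tableRed)
open Summit.QuantumFields.BalabanUV.Beta.D1BFx.ReducedKernel (TableR)
open Summit.QuantumFields.BalabanUV.Beta.D1BFx.PackedCoframePairLimit (cofPairInf)
open Summit.QuantumFields.BalabanUV.Beta.D1BFx.PackedSortedBridges (embFF)
open ExpKernelCalculus (Zl)

namespace Summit.QuantumFields.BalabanUV.Beta.D1BFx.RoadEndBFxRoadScalesC2S

open Summit.QuantumFields.BalabanUV.Beta.D1BFx.RoadEndBFxRoadScalesJ3S (d1Rep_BFx_road_scales_J3_sbpS)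
open Summit.QuantumFields.BalabanUV.Beta.D1BFx.CoframeTableMassScales (exists_C2_letters)


open Summit.QuantumFields.BalabanUV.Beta.D1BFx.RoadEndBFxRoadScalesC1S (d1Rep_BFx_road_scales_C1_sbpS)
open Summit.QuantumFields.BalabanUV.Beta.D1BFx.GhostDeficitFormula (J3_closed_form)
open Summit.QuantumFields.BalabanUV.Beta.D1BFx.GhostStencilRooted (qAntiAt)
open Summit.QuantumFields.BalabanUV.Beta.D1BFx.GhostStencilRootedReflection (ctrHalf)
open Summit.QuantumFields.BalabanUV.Beta.D1BFx.GhostAveragingSquare (qSqAt)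
open Summit.QuantumFields.BalabanUV.Beta.D1BFx.GhostKernelComplete (absMoment₂_PghQ)
open ExpKernelCalculus (tadpole bubble)
open Literature.MathematicalPhysics.QuantumFieldTheory.Balaban1983to89.Beta.ScalewiseWitness (secondMoment_smul secondMoment_add absMoment₂_const_mul)
open Literature.MathematicalPhysics.QuantumFieldTheory.Balaban1983to89.Beta.StepDriftWitness (absMoment₂_add_gen)



open Summit.QuantumFields.BalabanUV.Beta.D1BFx.RoadEndBFxRoadScalesS (d1Rep_BFx_road_scales_sbpS)
open Summit.QuantumFields.BalabanUV.Beta.D1BFx.CoframeJetMassScales (exists_C1_letters)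
open B5Hk163Strip (kappa163_pos)


variable {Lc : ℕ} [NeZero Lc] {a N cgh₀ : ℝ} {μ ν : Fin 4}
  {cE cVH cΛ cR cK cQ cE₂ cJ4 cΛ₂ cR₂ cQ₂ x₀ ωgl ωgh cgh : ℕ → ℝ} {WE WJ WΛ WR WQ : ℕ → TableR} {CE CJ CΛt CRt CQ δW : ℕ → ℝ}
  {TΛ WA : ℕ → Fin 4 → Site 4 → Fin 4 → Site 4 → MKer 4 (Fin 4)} {CT δT : ℕ → ℝ}
  {ε : ℕ → ℝ} {X : ℕ → Site 4 → MKer 4 (Fin 4)} {Cx δx : ℕ → ℝ}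

/-- [folklore] **ROAD BF-x ⟹ THE SPINE's `D1Rep`, AT THE ROAD's OBJECTS, ON THE SCALES — (C1)(C2) DISCHARGED, (J3) IN CLOSED FORM** — PART 16 with the
(C2) letter `hκc hCs' hCm` supplied by leaf-03 g25's `exists_C2_letters hL ha hr μ ν`; five binders fewer, nothing added.  Everything else VERBATIM PART 16. -/
theorem d1Rep_BFx_road_scales_C2_sbpS (Js : ℕ → JetData 3 Lc) (hμν : μ ≠ ν) (hN : N ≠ 0) (hL : 2 ≤ Lc) (hodd : Odd Lc)
    (ha : 0 < a)
    (h12 : B5.Prop12Printed (fam nOf hn1 MOf a ha)) (h126 : B5.Kernel126_127Printed (kfam nOf MOf))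
    -- bridge B1 REPLACED: composite jet data, the printed symmetries of the flipped step kernels, the spine's `D1Tel`, the one-shot (K)-estimate
    (Jc : ∀ m : ℕ, JetData 3 (Lc ^ m))
    (hW : ∀ j, WardTransversal (flipK (TbalOf Lc Js j))) (hRfl : ∀ j, AxisReflectionCovariant (flipK (TbalOf Lc Js j)))
    (htel : D1Tel Lc Js Jc)
    -- ===== THE (K) SLOT AT THE ROAD's OBJECTS (PART 10 `PackedRoadHptwScales.hptw_of_junctions`): per-scale block roots, the literal's stencil
    -- ===== families with their STRUCTURAL SOCKETS, torus sequences, per-bond torus pins, LIFTED [P1′]∕[P2′], and the junctions (J1)(J2)(J3)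
    -- the block roots, per scale
    (r : ℕ → Fin 4 → ℕ) (hr : ∀ m : ℕ, r (m + 1) ∈ box (3 + 1) (m + 1))
    -- the literal's first-derivative stencil families, per scale, and their STRUCTURAL SOCKETS
    (S : ℕ → Fin 4 → (Fin 4 → ℤ) → MKer 4 (Fib 3)) {Cs δS : ℕ → ℝ} (hS : ∀ n : ℕ, 2 ≤ n → LocStencil (S n) (Cs n) (δS n))
    (hCs : ∀ n, 0 ≤ Cs n) (hδS : ∀ n, 0 < δS n)
    (hScovB : ∀ n : ℕ, 2 ≤ n → ∀ κ' u t, S n κ' (u + ((n : ℕ) : ℤ) • t) = shiftK (-(((n : ℕ) : ℤ) • t)) (S n κ' u))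
    (hSmm : ∀ n : ℕ, 2 ≤ n → ∀ κ' u x y (c b : Fin 4), S n κ' u x y (Sum.inr c) (Sum.inr b) = 0)
    (hSfm : ∀ n : ℕ, 2 ≤ n → ∀ κ' u x y (c b : Fin 4), S n κ' u x y (Sum.inl c) (Sum.inr b) = S n κ' u y x (Sum.inr b) (Sum.inl c))
    (hSff : ∀ n : ℕ, 2 ≤ n → ∀ κ' u x y (c b : Fin 4), S n κ' u x y (Sum.inl c) (Sum.inl b) = -S n κ' u y x (Sum.inl b) (Sum.inl c))
    -- the literal's second-derivative stencil families, per scale, and their STRUCTURAL SOCKETS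
    (S₂ : ℕ → Fin 4 → (Fin 4 → ℤ) → Fin 4 → (Fin 4 → ℤ) → MKer 4 (Fib 3)) {Ck δ₂ : ℕ → ℝ}
    (hS₂ : ∀ n : ℕ, 2 ≤ n → ∀ κ u κ' u', BiLoc (S₂ n κ u κ' u') u u (Ck n * Real.exp (-δ₂ n * l1 (u' - u))) (δ₂ n))
    (hCk : ∀ n, 0 ≤ Ck n) (hδ₂ : ∀ n, 0 < δ₂ n)
    (hS₂covB : ∀ n : ℕ, 2 ≤ n → ∀ κ' κ'' u u' t, S₂ n κ' (u + ((n : ℕ) : ℤ) • t) κ'' (u' + ((n : ℕ) : ℤ) • t)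
      = shiftK (-(((n : ℕ) : ℤ) • t)) (S₂ n κ' u κ'' u'))
    (hS₂mm : ∀ n : ℕ, 2 ≤ n → ∀ κ u κ' u' x y (c b : Fin 4), S₂ n κ u κ' u' x y (Sum.inr c) (Sum.inr b) = 0)
    (hS₂fm : ∀ n : ℕ, 2 ≤ n → ∀ κ u κ' u' x y (c b : Fin 4),
      S₂ n κ u κ' u' x y (Sum.inl c) (Sum.inr b) = -S₂ n κ u κ' u' y x (Sum.inr b) (Sum.inl c))
    (hS₂ff : ∀ n : ℕ, 2 ≤ n → ∀ κ u κ' u' x y (c b : Fin 4),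
      S₂ n κ u κ' u' x y (Sum.inl c) (Sum.inl b) = S₂ n κ u κ' u' y x (Sum.inl b) (Sum.inl c))
    -- the torus sequences, per scale
    (p : ℕ → ℕ → ℕ) [∀ n k, NeZero (p n k)] (hp : ∀ n, Tendsto (p n) atTop atTop)
    -- the literal's per-bond torus data, per scale, PINNED to the periodised single-bond ∕ pair stencil arrays and THE CONVENTION's generator jets
    (K₁ : ∀ (n : ℕ) [NeZero n] (k : ℕ), I 3 n (p n k) ⊕ J 3 (p n k) → Matrix (I 3 n (p n k)) (I 3 n (p n k)) ℝ)
    (Q₁ : ∀ (n : ℕ) [NeZero n] (k : ℕ), I 3 n (p n k) ⊕ J 3 (p n k) → Matrix (J 3 (p n k)) (I 3 n (p n k)) ℝ)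
    (x₁ : ∀ (n : ℕ) [NeZero n] (k : ℕ), I 3 n (p n k) ⊕ J 3 (p n k) → Matrix (I 3 n (p n k)) (CombRows (toSite (r n)) n (p n k)) ℝ)
    (K₂ : ∀ (n : ℕ) [NeZero n] (k : ℕ), I 3 n (p n k) ⊕ J 3 (p n k) → I 3 n (p n k) ⊕ J 3 (p n k) → Matrix (I 3 n (p n k)) (I 3 n (p n k)) ℝ)
    (Q₂ : ∀ (n : ℕ) [NeZero n] (k : ℕ), I 3 n (p n k) ⊕ J 3 (p n k) → I 3 n (p n k) ⊕ J 3 (p n k) → Matrix (J 3 (p n k)) (I 3 n (p n k)) ℝ)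
    (x₂ : ∀ (n : ℕ) [NeZero n] (k : ℕ), I 3 n (p n k) ⊕ J 3 (p n k) → I 3 n (p n k) ⊕ J 3 (p n k) →
      Matrix (I 3 n (p n k)) (CombRows (toSite (r n)) n (p n k)) ℝ)
    (hK₁ : ∀ n : ℕ, 2 ≤ n → ∀ [NeZero n], ∀ k i, K₁ n k (Sum.inl i) = Matrix.of (periodiseF (p n k) (fTL (sortK n (arr (n * p n k)
      (S n i.2.2 (windowMap 4 (n * p n k) (torusBlockEquiv n (p n k) (i.1, i.2.1)))))))))
    (hQ₁ : ∀ n : ℕ, 2 ≤ n → ∀ [NeZero n], ∀ k i, Q₁ n k (Sum.inl i) = Matrix.of (periodiseF (p n k) (fBL (sortK n (arr (n * p n k)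
      (S n i.2.2 (windowMap 4 (n * p n k) (torusBlockEquiv n (p n k) (i.1, i.2.1)))))))))
    (hx₁ : ∀ n : ℕ, 2 ≤ n → ∀ [NeZero n], ∀ k i, x₁ n k (Sum.inl i) = (Djet (n * p n k) (e₁ n (p n k) i)).submatrix (e₁ n (p n k)) id * Nhat (r n) n (p n k))
    (hK₂ : ∀ n : ℕ, 2 ≤ n → ∀ [NeZero n], ∀ k i j, K₂ n k (Sum.inl i) (Sum.inl j) = Matrix.of (periodiseF (p n k) (fTL (sortK n (fun x y c b => ∑' t : Fin 4 → ℤ,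
      arr (n * p n k) (S₂ n i.2.2 (windowMap 4 (n * p n k) (torusBlockEquiv n (p n k) (i.1, i.2.1))) j.2.2
        (imageShift (n * p n k) (windowMap 4 (n * p n k) (torusBlockEquiv n (p n k) (j.1, j.2.1))) t)) x y c b)))))
    (hQ₂ : ∀ n : ℕ, 2 ≤ n → ∀ [NeZero n], ∀ k i j, Q₂ n k (Sum.inl i) (Sum.inl j) = Matrix.of (periodiseF (p n k) (fBL (sortK n (fun x y c b => ∑' t : Fin 4 → ℤ,
      arr (n * p n k) (S₂ n i.2.2 (windowMap 4 (n * p n k) (torusBlockEquiv n (p n k) (i.1, i.2.1))) j.2.2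
        (imageShift (n * p n k) (windowMap 4 (n * p n k) (torusBlockEquiv n (p n k) (j.1, j.2.1))) t)) x y c b)))))
    (hx₂ : ∀ n : ℕ, 2 ≤ n → ∀ [NeZero n], ∀ k i j, x₂ n k (Sum.inl i) (Sum.inl j) = if i = j then x₁ n k (Sum.inl i) else 0)
    (hK₁0 : ∀ n : ℕ, 2 ≤ n → ∀ [NeZero n], ∀ k j, K₁ n k (Sum.inr j) = 0) (hQ₁0 : ∀ n : ℕ, 2 ≤ n → ∀ [NeZero n], ∀ k j, Q₁ n k (Sum.inr j) = 0)
    (hx₁0 : ∀ n : ℕ, 2 ≤ n → ∀ [NeZero n], ∀ k j, x₁ n k (Sum.inr j) = 0)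
    (hK₂0 : ∀ n : ℕ, 2 ≤ n → ∀ [NeZero n], ∀ k j q, K₂ n k (Sum.inr j) q = 0) (hK₂0' : ∀ n : ℕ, 2 ≤ n → ∀ [NeZero n], ∀ k q j, K₂ n k q (Sum.inr j) = 0)
    (hQ₂0 : ∀ n : ℕ, 2 ≤ n → ∀ [NeZero n], ∀ k j q, Q₂ n k (Sum.inr j) q = 0) (hQ₂0' : ∀ n : ℕ, 2 ≤ n → ∀ [NeZero n], ∀ k q j, Q₂ n k q (Sum.inr j) = 0)
    (hx₂0 : ∀ n : ℕ, 2 ≤ n → ∀ [NeZero n], ∀ k j q, x₂ n k (Sum.inr j) q = 0) (hx₂0' : ∀ n : ℕ, 2 ≤ n → ∀ [NeZero n], ∀ k q j, x₂ n k q (Sum.inr j) = 0)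
    -- the literal's LIFTED table-level Ward identities [P1′]∕[P2′] in the `ad e₃` model (ρ-g16-1′), per torus
    (C : Fin 3 → Matrix (Fin 3) (Fin 3) ℝ) (hC : C 2 = c₃)
    (hP1 : ∀ n : ℕ, 2 ≤ n → ∀ [NeZero n], ∀ k, ∀ q : Fin 3 × (I 3 n (p n k) ⊕ J 3 (p n k)),
      (C q.1 ⊗ₖ kkt (K₁ n k q.2) (Q₁ n k q.2))
          * ((1 : Matrix (Fin 3) (Fin 3) ℝ) ⊗ₖ Matrix.fromRows (What0 (r n) n (p n k)) (0 : Matrix (J 3 (p n k)) (CombRows (toSite (r n)) n (p n k)) ℝ))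
      + ((1 : Matrix (Fin 3) (Fin 3) ℝ) ⊗ₖ kkt (Khat (d := 3) n (p n k)) (Qhat (d := 3) n (p n k)))
          * (C q.1 ⊗ₖ Matrix.fromRows (x₁ n k q.2) (0 : Matrix (J 3 (p n k)) (CombRows (toSite (r n)) n (p n k)) ℝ))
      + oslot (fun q' : Fin 3 × (I 3 n (p n k) ⊕ J 3 (p n k)) =>
            C q'.1 ⊗ₖ Matrix.fromRows (x₁ n k q'.2) (0 : Matrix (J 3 (p n k)) (CombRows (toSite (r n)) n (p n k)) ℝ))
          (fun i => ((1 : Matrix (Fin 3) (Fin 3) ℝ) ⊗ₖ kkt (Khat (d := 3) n (p n k)) (Qhat (d := 3) n (p n k))) i q) = 0)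
    (hP2 : ∀ n : ℕ, 2 ≤ n → ∀ [NeZero n], ∀ k, ∀ q q'' : Fin 3 × (I 3 n (p n k) ⊕ J 3 (p n k)),
      ((C q.1 * C q''.1) ⊗ₖ kkt (K₂ n k q.2 q''.2) (Q₂ n k q.2 q''.2))
          * ((1 : Matrix (Fin 3) (Fin 3) ℝ) ⊗ₖ Matrix.fromRows (What0 (r n) n (p n k)) (0 : Matrix (J 3 (p n k)) (CombRows (toSite (r n)) n (p n k)) ℝ))
      + (C q.1 ⊗ₖ kkt (K₁ n k q.2) (Q₁ n k q.2))
          * (C q''.1 ⊗ₖ Matrix.fromRows (x₁ n k q''.2) (0 : Matrix (J 3 (p n k)) (CombRows (toSite (r n)) n (p n k)) ℝ))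
      + (C q''.1 ⊗ₖ kkt (K₁ n k q''.2) (Q₁ n k q''.2))
          * (C q.1 ⊗ₖ Matrix.fromRows (x₁ n k q.2) (0 : Matrix (J 3 (p n k)) (CombRows (toSite (r n)) n (p n k)) ℝ))
      + ((1 : Matrix (Fin 3) (Fin 3) ℝ) ⊗ₖ kkt (Khat (d := 3) n (p n k)) (Qhat (d := 3) n (p n k)))
          * ((C q.1 * C q''.1) ⊗ₖ Matrix.fromRows (x₂ n k q.2 q''.2) (0 : Matrix (J 3 (p n k)) (CombRows (toSite (r n)) n (p n k)) ℝ))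
      + oslot (fun q' : Fin 3 × (I 3 n (p n k) ⊕ J 3 (p n k)) =>
            C q'.1 ⊗ₖ Matrix.fromRows (x₁ n k q'.2) (0 : Matrix (J 3 (p n k)) (CombRows (toSite (r n)) n (p n k)) ℝ))
          (fun i => (C q''.1 ⊗ₖ kkt (K₁ n k q''.2) (Q₁ n k q''.2)) i q)
      + oslot (fun q' : Fin 3 × (I 3 n (p n k) ⊕ J 3 (p n k)) =>
            (C q''.1 * C q'.1) ⊗ₖ Matrix.fromRows (x₂ n k q''.2 q'.2) (0 : Matrix (J 3 (p n k)) (CombRows (toSite (r n)) n (p n k)) ℝ))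
          (fun i => ((1 : Matrix (Fin 3) (Fin 3) ℝ) ⊗ₖ kkt (Khat (d := 3) n (p n k)) (Qhat (d := 3) n (p n k))) i q)
      + oslot (fun p' : Fin 3 × (I 3 n (p n k) ⊕ J 3 (p n k)) =>
            (C q.1 * C p'.1) ⊗ₖ Matrix.fromRows (x₂ n k q.2 p'.2) (0 : Matrix (J 3 (p n k)) (CombRows (toSite (r n)) n (p n k)) ℝ))
          (fun i => ((1 : Matrix (Fin 3) (Fin 3) ℝ) ⊗ₖ kkt (Khat (d := 3) n (p n k)) (Qhat (d := 3) n (p n k))) i q'') = 0)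
    -- (J1) S-LIT, per exponent: the spine's one-shot kernel at scale `Lc^m` IS the road's main M-side object (d1-p3's `JcOf`; displayed)
    (hJ1 : ∀ m : ℕ, 1 ≤ m → ∀ z : Site 4, TshotOf Lc Jc m μ ν z
      = hessKer (coDressKBmAt (toSite (r (Lc ^ m))) (Lc ^ m) (KInvStep (d := 3) (Lc ^ m) 0))
          (vertexOfK (coDressKBmAt (toSite (r (Lc ^ m))) (Lc ^ m) (KInvStep (d := 3) (Lc ^ m) 0)) (Lc ^ m) (S (Lc ^ m)))
          (vertex2OfK (coDressKBmAt (toSite (r (Lc ^ m))) (Lc ^ m) (KInvStep (d := 3) (Lc ^ m) 0)) (Lc ^ m) (S₂ (Lc ^ m))) μ ν z)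
    -- (J2) the (A2-N) TABLE dictionary AT THE END's LETTERS, per scale, with a rest KERNEL `RJ2 n` (an2's Q-DICT-N; displayed)
    (RJ2 : ℕ → Fin 4 → Fin 4 → Site 4 → ℝ)
    (hJ2 : ∀ n : ℕ, 2 ≤ n → ∀ [NeZero n], ∀ z : Site 4,
      ((2 : ℝ)⁻¹) ^ 2 * TOfLeg n (Ga n a) (fun κ u => blk (coProjBmAtK (toSite (r n)) n (SN (n - 1) a (S n)) κ u) true true)
            (fun μ' y ν' y' => ((2 : ℝ)⁻¹)⁻¹ • ffW (W2NInf (n - 1) a (r n) (S₂ n)) μ' y ν' y') μ ν z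
      = ωgl n * TOfRed n a (SbfBal n a (cE n) (cVH n) (cΛ n) (cR n) (cK n) (cQ n))
          (tableRed n (Wbf (cE₂ n) (cJ4 n) (cΛ₂ n) (cR₂ n) (cQ₂ n) (WE n) (WJ n) (WΛ n) (WR n) (WQ n))) μ ν z + RJ2 n μ ν z)
    -- (J3): NO HYPOTHESIS — the junction holds with an explicit rest (`GhostDeficitFormula.J3_closed_form`); its rows are displayed below as (C3) + the GAP ROW
    -- ===== THE LANES' INPUTS ON THE SCALES after (C1): the (L1) FLOOR of the literal's first-stencil rate `hδS₀ hδS₀₂` and units inequality `huS`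
    -- ===== (the rate `σV` of PART 14 is CHOSEN INSIDE, its (C1) letter `hTs hTm` is leaf-03 g25's `exists_C1_letters`), the (L2) floor ∕ units
    -- ===== `hδ₂₀ hδ₂₀₂ huT`, the co-frame table rate `κc` and the DISPLAYED co-frame table letter (C2) on the scales (`hCs' hCm`); the comb-FP lane AND
    -- ===== the ghost lane take NO letter; the junction rests' rows below
    {δS₀ uS δ₂₀ uT : ℝ}
    (hδS₀ : 0 < δS₀) (hδS₀₂ : ∀ n : ℕ, 2 ≤ n → δS₀ / (n : ℝ) ≤ δS n)
    (huS : ∀ n : ℕ, 2 ≤ n → 16 * Cs n * Zl 4 (δS n / 2) ^ 2 ≤ uS)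
    (hδ₂₀ : 0 < δ₂₀) (hδ₂₀₂ : ∀ n : ℕ, 2 ≤ n → δ₂₀ / (n : ℝ) ≤ δ₂ n) (huT : ∀ n : ℕ, 2 ≤ n → 16 * Ck n * Zl 4 (δ₂ n / 2) ^ 2 ≤ uT)
    -- (C2): NO HYPOTHESIS — leaf-03 g25's `CoframeTableMassScales.exists_C2_letters` (gan24-leaf-05 g54's δ4b) supplies `κc mC hκc hCs' hCm` inside
    {CJ2 : ℝ}
    (hMR₂ : ∀ m : ℕ, 1 ≤ m → AbsMoment₂ (RJ2 (Lc ^ m) μ ν)) (hC₂ : ∀ m : ℕ, 1 ≤ m → |B12Beta.secondMoment (RJ2 (Lc ^ m)) μ ν| ≤ CJ2)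
    -- (C3) the four `Q′`-words of the explicit (J3) rest, on the scales: absolutely summable (all channels) and `m`-uniformly bounded (1.22) second moments
    {CB Cgap : ℝ}
    (hMRB : ∀ m : ℕ, 1 ≤ m → ∀ c e : Fin 4, AbsMoment₂ (fun z : Site 4 =>
      ((1 / 2) * tadpole (Ggh (Lc ^ m) a) (∑ κ : Fin 4, ∑ l : Fin 4, wsum (colH (coDressKBmAt (toSite (r (Lc ^ m))) (Lc ^ m) (KInvStep (d := 3) (Lc ^ m) 0)) (Lc ^ m) c 0 κ)
            (fun u => wsum (colH (coDressKBmAt (toSite (r (Lc ^ m))) (Lc ^ m) (KInvStep (d := 3) (Lc ^ m) 0)) (Lc ^ m) e z l)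
              (fun v' => (-((-1) * a * (((Lc ^ m) : ℕ) : ℝ) ^ 4)) • qSqAt (ctrHalf (Lc ^ m)) (Lc ^ m) κ u l v')))
        - (1 / 2) * (bubble (Ggh (Lc ^ m) a)
              (∑ κ : Fin 4, wsum (colH (coDressKBmAt (toSite (r (Lc ^ m))) (Lc ^ m) (KInvStep (d := 3) (Lc ^ m) 0)) (Lc ^ m) c 0 κ) (fun u => ((((Lc ^ m) : ℕ) : ℝ) ^ 2) • ghCur κ u))
              (∑ κ : Fin 4, wsum (colH (coDressKBmAt (toSite (r (Lc ^ m))) (Lc ^ m) (KInvStep (d := 3) (Lc ^ m) 0)) (Lc ^ m) e z κ) (fun u => a • qAntiAt (ctrHalf (Lc ^ m)) (Lc ^ m) κ u))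
            + bubble (Ggh (Lc ^ m) a)
              (∑ κ : Fin 4, wsum (colH (coDressKBmAt (toSite (r (Lc ^ m))) (Lc ^ m) (KInvStep (d := 3) (Lc ^ m) 0)) (Lc ^ m) c 0 κ) (fun u => a • qAntiAt (ctrHalf (Lc ^ m)) (Lc ^ m) κ u))
              (∑ κ : Fin 4, wsum (colH (coDressKBmAt (toSite (r (Lc ^ m))) (Lc ^ m) (KInvStep (d := 3) (Lc ^ m) 0)) (Lc ^ m) e z κ) (fun u => ((((Lc ^ m) : ℕ) : ℝ) ^ 2) • ghCur κ u))
            + bubble (Ggh (Lc ^ m) a)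
              (∑ κ : Fin 4, wsum (colH (coDressKBmAt (toSite (r (Lc ^ m))) (Lc ^ m) (KInvStep (d := 3) (Lc ^ m) 0)) (Lc ^ m) c 0 κ) (fun u => a • qAntiAt (ctrHalf (Lc ^ m)) (Lc ^ m) κ u))
              (∑ κ : Fin 4, wsum (colH (coDressKBmAt (toSite (r (Lc ^ m))) (Lc ^ m) (KInvStep (d := 3) (Lc ^ m) 0)) (Lc ^ m) e z κ) (fun u => a • qAntiAt (ctrHalf (Lc ^ m)) (Lc ^ m) κ u))))))
    (hCB : ∀ m : ℕ, 1 ≤ m → |B12Beta.secondMoment (fun (c e : Fin 4) (z : Site 4) =>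
      ((1 / 2) * tadpole (Ggh (Lc ^ m) a) (∑ κ : Fin 4, ∑ l : Fin 4, wsum (colH (coDressKBmAt (toSite (r (Lc ^ m))) (Lc ^ m) (KInvStep (d := 3) (Lc ^ m) 0)) (Lc ^ m) c 0 κ)
            (fun u => wsum (colH (coDressKBmAt (toSite (r (Lc ^ m))) (Lc ^ m) (KInvStep (d := 3) (Lc ^ m) 0)) (Lc ^ m) e z l)
              (fun v' => (-((-1) * a * (((Lc ^ m) : ℕ) : ℝ) ^ 4)) • qSqAt (ctrHalf (Lc ^ m)) (Lc ^ m) κ u l v')))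
        - (1 / 2) * (bubble (Ggh (Lc ^ m) a)
              (∑ κ : Fin 4, wsum (colH (coDressKBmAt (toSite (r (Lc ^ m))) (Lc ^ m) (KInvStep (d := 3) (Lc ^ m) 0)) (Lc ^ m) c 0 κ) (fun u => ((((Lc ^ m) : ℕ) : ℝ) ^ 2) • ghCur κ u))
              (∑ κ : Fin 4, wsum (colH (coDressKBmAt (toSite (r (Lc ^ m))) (Lc ^ m) (KInvStep (d := 3) (Lc ^ m) 0)) (Lc ^ m) e z κ) (fun u => a • qAntiAt (ctrHalf (Lc ^ m)) (Lc ^ m) κ u))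
            + bubble (Ggh (Lc ^ m) a)
              (∑ κ : Fin 4, wsum (colH (coDressKBmAt (toSite (r (Lc ^ m))) (Lc ^ m) (KInvStep (d := 3) (Lc ^ m) 0)) (Lc ^ m) c 0 κ) (fun u => a • qAntiAt (ctrHalf (Lc ^ m)) (Lc ^ m) κ u))
              (∑ κ : Fin 4, wsum (colH (coDressKBmAt (toSite (r (Lc ^ m))) (Lc ^ m) (KInvStep (d := 3) (Lc ^ m) 0)) (Lc ^ m) e z κ) (fun u => ((((Lc ^ m) : ℕ) : ℝ) ^ 2) • ghCur κ u))
            + bubble (Ggh (Lc ^ m) a)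
              (∑ κ : Fin 4, wsum (colH (coDressKBmAt (toSite (r (Lc ^ m))) (Lc ^ m) (KInvStep (d := 3) (Lc ^ m) 0)) (Lc ^ m) c 0 κ) (fun u => a • qAntiAt (ctrHalf (Lc ^ m)) (Lc ^ m) κ u))
              (∑ κ : Fin 4, wsum (colH (coDressKBmAt (toSite (r (Lc ^ m))) (Lc ^ m) (KInvStep (d := 3) (Lc ^ m) 0)) (Lc ^ m) e z κ) (fun u => a • qAntiAt (ctrHalf (Lc ^ m)) (Lc ^ m) κ u))))) μ ν| ≤ CB)
    -- THE GHOST NORMALISATION GAP ROW (F-g20-1): the END's expected ghost main term minus the road's, `(4N²n⁸ − 2)·PghQ(unit ray)`, must have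
    -- `m`-uniformly bounded (1.22) second moment — `= (4N² − 2n⁻⁸)·(the uniform base-point average of the punctured full sums of the unit-ray fine ghost
    -- Hessian)` by `AssemblySlots.hF_PghQ_ray`; displayed, NOT asserted
    (hGap : ∀ m : ℕ, 1 ≤ m → |(4 * N ^ 2 * ((Lc ^ m : ℕ) : ℝ) ^ 8 - 2)
        * B12Beta.secondMoment (fun (c e : Fin 4) (z : Site 4) => PghQ (Lc ^ m) a (-1) (((Lc ^ m : ℕ) : ℝ) ^ 2) a c e z) μ ν| ≤ Cgap)
    -- the RESCALED loop-weight tie of reading (ii): displayed scalar family `s`, pinned `s n = n⁻²`; the normalisation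
    (s : ℕ → ℝ) (hs : ∀ n : ℕ, 2 ≤ n → s n = ((n : ℝ) ^ 2)⁻¹) (hωs : ∀ n : ℕ, 2 ≤ n → ωgh n * (s n * cK n) ^ 2 = -2 * (ωgl n * cE n ^ 2))
    (hlam : ∀ n : ℕ, 2 ≤ n → ωgl n * cE n ^ 2 = 2 * N ^ 2 * (n : ℝ) ^ 8)
    -- pins and the ray (the rows' letters)
    (hcE : ∀ n : ℕ, 2 ≤ n → cE n = (n : ℝ) ^ 4) (hRsgn : ∀ n : ℕ, 2 ≤ n → cR n = -cE n) (hJ4 : ∀ n : ℕ, cJ4 n = 0)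
    (hcgh : ∀ n : ℕ, |cgh n| ≤ cgh₀) (hKray : ∀ n : ℕ, cK n = cgh n * (n : ℝ) ^ 2) (hQray : ∀ n : ℕ, cQ n = cgh n * a) (hx : ∀ n : ℕ, x₀ n = -cgh n)
    -- slot-table sockets (the END's), covariance, bond swap; `hdiv` (the ghost Ward rows `hrowgh` are a THEOREM on the ray: discharged inside)
    (hδW : ∀ n, 0 < δW n)
    (hE : ∀ n κ u l u', BiLoc (WE n κ u l u') u u' (CE n) (δW n)) (hJ : ∀ n κ u l u', BiLoc (WJ n κ u l u') u u' (CJ n) (δW n))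
    (hΛ : ∀ n κ u l u', BiLoc (WΛ n κ u l u') u u' (CΛt n) (δW n)) (hR : ∀ n κ u l u', BiLoc (WR n κ u l u') u u' (CRt n) (δW n))
    (hQ : ∀ n κ u l u', BiLoc (WQ n κ u l u') u u' (CQ n) (δW n))
    (hEc : ∀ (n : ℕ) (κ : Fin 4) (u : Site 4) (l : Fin 4) (u' t : Site 4),
      WE n κ (u + (n : ℤ) • t) l (u' + (n : ℤ) • t) = shiftK (-((n : ℤ) • t)) (WE n κ u l u'))
    (hJc : ∀ (n : ℕ) (κ : Fin 4) (u : Site 4) (l : Fin 4) (u' t : Site 4),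
      WJ n κ (u + (n : ℤ) • t) l (u' + (n : ℤ) • t) = shiftK (-((n : ℤ) • t)) (WJ n κ u l u'))
    (hΛc : ∀ (n : ℕ) (κ : Fin 4) (u : Site 4) (l : Fin 4) (u' t : Site 4),
      WΛ n κ (u + (n : ℤ) • t) l (u' + (n : ℤ) • t) = shiftK (-((n : ℤ) • t)) (WΛ n κ u l u'))
    (hRc : ∀ (n : ℕ) (κ : Fin 4) (u : Site 4) (l : Fin 4) (u' t : Site 4),
      WR n κ (u + (n : ℤ) • t) l (u' + (n : ℤ) • t) = shiftK (-((n : ℤ) • t)) (WR n κ u l u'))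
    (hQc : ∀ (n : ℕ) (κ : Fin 4) (u : Site 4) (l : Fin 4) (u' t : Site 4),
      WQ n κ (u + (n : ℤ) • t) l (u' + (n : ℤ) • t) = shiftK (-((n : ℤ) • t)) (WQ n κ u l u'))
    (hEs : ∀ n κ u l u', WE n κ u l u' = WE n l u' κ u) (hJs : ∀ n κ u l u', WJ n κ u l u' = WJ n l u' κ u)
    (hΛs : ∀ n κ u l u', WΛ n κ u l u' = WΛ n l u' κ u) (hRs : ∀ n κ u l u', WR n κ u l u' = WR n l u' κ u)
    (hQs : ∀ n κ u l u', WQ n κ u l u' = WQ n l u' κ u)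
    (hdiv : ∀ n : ℕ, 2 ≤ n → ∀ [NeZero n], ∀ (l' : Fin 4) (u' u : Site 4), ∑ κ' : Fin 4,
      (fineHess n a (SbfBal n a (cE n) (cVH n) (cΛ n) (cR n) (cK n) (cQ n))
          (Wbf (cE₂ n) (cJ4 n) (cΛ₂ n) (cR₂ n) (cQ₂ n) (WE n) (WJ n) (WΛ n) (WR n) (WQ n)) κ' l' (u - Pi.single κ' 1) u'
        - fineHess n a (SbfBal n a (cE n) (cVH n) (cΛ n) (cR n) (cK n) (cQ n))
          (Wbf (cE₂ n) (cJ4 n) (cΛ₂ n) (cR₂ n) (cQ₂ n) (WE n) (WJ n) (WΛ n) (WR n) (WQ n)) κ' l' u u') = 0)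
    -- (LOCAL) slot-E support and units; slot-R envelope and units (the three local ghost bubbles are SUPPLIED under reading (ii))
    {ρE : ℕ} {δ₀ kE : ℝ} (hδ₀ : 0 < δ₀) (hδE : ∀ n, δ₀ ≤ δW n)
    (hsuppE : ∀ n κ u l u', ρE < supNorm (u - u') → WE n κ u l u' = 0)
    (hkE : ∀ n : ℕ, 2 ≤ n → |ωgl n * cE₂ n| * CE n ≤ kE * (n : ℝ) ^ 8)
    {CwR δR : ℕ → ℝ} {θR δ₀R kR : ℝ} (hθR : 0 < θR) (hδR : ∀ n, 0 < δR n) (hδ₀R : 0 < δ₀R) (hδRge : ∀ n : ℕ, δ₀R / n ≤ δR n) (hCwR : ∀ n, 0 ≤ CwR n)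
    (hWRenv : ∀ n κ u l u', BiLoc (WR n κ u l u') u u' (CwR n * Real.exp (-(θR / n) * supNorm (u - u'))) (δR n))
    (hkR : ∀ n : ℕ, 2 ≤ n → |ωgl n * cR₂ n| * CwR n * (n : ℝ) ^ 6 ≤ kR)
    -- (Λ) sockets and zero-momentum data
    (hδT : ∀ n, 0 < δT n)
    (hdec : ∀ n : ℕ, 2 ≤ n → ∀ [NeZero n], ∀ κ u l u', WΛ n κ u l u' =
      (∑ m : Fin 4, OneStepResolventKernel.wsum (onLat n (fun y => lamCoeffOf (KInv (N := n) (d := 3)) n m y l u'))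
          (fun v => onLat n (fun y => TΛ n m y κ u) v))
      + (∑ m : Fin 4, OneStepResolventKernel.wsum (onLat n (fun y => lamCoeffOf (KInv (N := n) (d := 3)) n m y κ u))
          (fun v => onLat n (fun y => TΛ n m y l u') v))
      + WA n κ u l u')
    (hTloc : ∀ (n : ℕ) m y κ u, BiLoc (TΛ n m y κ u) ((n : ℤ) • y) ((n : ℤ) • y) (CT n * Real.exp (-δT n * l1 ((n : ℤ) • y - u))) (δT n))
    (hWAa : ∀ n κ u l u', trK (WA n κ u l u') = -WA n κ u l u') (hWAl : ∀ n κ u l u', Loc (WA n κ u l u'))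
    (hTcov : ∀ (n : ℕ) m y κ u t, TΛ n m (y + t) κ (u + (n : ℤ) • t) = shiftK (-((n : ℤ) • t)) (TΛ n m y κ u))
    (hcΛ : ∀ n : ℕ, 2 ≤ n → cΛ n ≠ 0) (hε : ∀ n : ℕ, ε n = 1 ∨ ε n = -1) (hδx : ∀ n, 0 < δx n) (hX : ∀ n u, BiLoc (X n u) u u (Cx n) (δx n))
    (hW1 : ∀ n : ℕ, 2 ≤ n → ∀ [NeZero n], ∀ u,
      comp (comp (Ga n a) (divV (fun κ v => ε n • SbfBal n a (cE n) (cVH n) (cΛ n) (cR n) (cK n) (cQ n) κ v) u)) (Ga n a) =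
        comp (Ga n a) (X n u) - comp (X n u) (Ga n a))
    (hW2 : ∀ n : ℕ, 2 ≤ n → ∀ [NeZero n], ∀ (m : Fin 4) (u : Site 4),
      divV (fun κ v => (-(ε n * (cΛ₂ n / cΛ n))) • TΛ n m 0 κ v) u = comp (X n u) (ffOf (hessFF n m 0)) - comp (ffOf (hessFF n m 0)) (X n u))
    -- (N) slot Q's SOCKETS (the (A2) readout of `WQ`: a decaying bi-localisation envelope at a BLOCK-scale rate floor and its units line — T₈ ⟸ `NeedleTadpoleRowDecay`)
    {CwQ δQ : ℕ → ℝ} {θQ δ₀Q kQ : ℝ} (hθQ : 0 < θQ) (hδQ : ∀ n, 0 < δQ n) (hδ₀Q : 0 < δ₀Q) (hδQge : ∀ n : ℕ, δ₀Q / n ≤ δQ n) (hCwQ : ∀ n, 0 ≤ CwQ n)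
    (hWQenv : ∀ n κ u l u', BiLoc (WQ n κ u l u') u u' (CwQ n * Real.exp (-(θQ / n) * supNorm (u - u'))) (δQ n))
    (hkQ : ∀ n : ℕ, 2 ≤ n → |ωgl n * cQ₂ n| * CwQ n * (n : ℝ) ^ 6 ≤ kQ)
    -- base-point labels of the free one-shot side (the spine root's `hSL` ∕ `k`); the Literature's window data is discharged at `M := id`, `cc := 1`
    {L : Type*} {SL : Finset L} (hSL : SL.Nonempty) (k : L → Fin 4) :
    D1Rep Lc Jc N μ ν a SL k := by
  -- (C2) «TB4-W CO-FRAME TABLE, m-UNIFORM MASS» on the scales: leaf-03 g25's theorem, BY NAME, at the road's own roots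
  obtain ⟨κc, hκc, mC, hC2⟩ := exists_C2_letters (L := Lc) (a := a) hL ha hr μ ν
  exact d1Rep_BFx_road_scales_J3_sbpS Js hμν hN hL hodd ha h12 h126 Jc hW hRfl htel r hr S hS hCs hδS hScovB hSmm hSfm hSff S₂ hS₂ hCk hδ₂ hS₂covB
    hS₂mm hS₂fm hS₂ff p hp K₁ Q₁ x₁ K₂ Q₂ x₂ hK₁ hQ₁ hx₁ hK₂ hQ₂ hx₂ hK₁0 hQ₁0 hx₁0 hK₂0 hK₂0' hQ₂0 hQ₂0' hx₂0 hx₂0' C hC hP1 hP2 hJ1 RJ2 hJ2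
    hδS₀ hδS₀₂ huS hδ₂₀ hδ₂₀₂ huT hκc (fun k hk z j i => (hC2 k hk z j i).1) (fun k hk z j i => (hC2 k hk z j i).2) hMR₂ hC₂ hMRB hCB hGap s hs hωs hlam
    hcE hRsgn hJ4 hcgh hKray hQray hx hδW hE hJ hΛ hR hQ hEc hJc hΛc hRc hQc hEs hJs hΛs hRs hQs hdiv hδ₀ hδE hsuppE hkE hθR hδR hδ₀R hδRge hCwR hWRenv
    hkR hδT hdec hTloc hWAa hWAl hTcov hcΛ hε hδx hX hW1 hW2 hθQ hδQ hδ₀Q hδQge hCwQ hWQenv hkQ hSL k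

end Summit.QuantumFields.BalabanUV.Beta.D1BFx.RoadEndBFxRoadScalesC2S

end
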